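import Mathlib.MeasureTheory.Integral.Marginal
import Mathlib.MeasureTheory.Measure.ProbabilityMeasure
import HarnessLib

/-!
# Iterated integration of pivoted products over a product of probability spaces (cell ym3-torus, rung R3, crux K1
# `PoincareLipschitz.MesoscopicConcentrationL` stmt-QuantumFields-23532, LINE 29 brick (i): the β-uniform plaquette tail)

Kernel-checked helper (def-free); proves nothing about any crux, rung or summit statement; YM₃ on T³ is rung R3 —
NOT d = 4, NOT infinite volume, NOT a mass gap, NOT Clay.

WHAT.  An abstract «link elimination» lemma for product probability measures `π = ⨂_{i ∈ ι} μ_i`.  Let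
`(f_k)_{k ∈ F}` be finitely many non-negative measurable functions on the product space, each with a PIVOT
coordinate `piv k` and a RANK `rank k` in a linear order, such that

* (independence below the pivot) for `k ≠ k'` in `F` with `rank k' ≤ rank k`, `f_{k'}` does not depend on the
  coordinate `piv k`;
* (the pivot integrates to a constant) `∫ f_k(x[piv k ↦ y]) dμ_{piv k}(y) = c_k` for every `x`.

Then `∫ ∏_{k ∈ F} f_k dπ = ∏_{k ∈ F} c_k` (`lintegral_prod_eq_prod_of_pivot`): integrate out the pivot of the
rank-maximal factor first (no other factor sees it), and induct.  This is the mechanism behind two classical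
lattice-gauge-theory computations: (i) in an axial∕comb gauge the Wilson partition function of a set of plaquettes each
owning a «last» link factorises into one-link integrals (exactly in `d = 2`: the Gross–Witten∕Migdal factorisation;
as an UPPER bound in every `d` after dropping plaquettes), and (ii) the gauge-tree lower bound, where each cotree
link owns its own ball constraint.  Both uses are in the companion files `MesoscopicConcentrationCombTransport` / `…CombElimination`.

Tool: Mathlib's marginal integrals `MeasureTheory.lmarginal` (`lintegral_eq_of_lmarginal_eq`,
`lmarginal_singleton`) and `Finset.induction_on_max_value`.

References: E. Seiler, *Gauge Theories as a Problem of Constructive Quantum Field Theory and Statistical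
Mechanics*, LNP **159** (1982), §§2–3 (axial gauge, two-dimensional factorisation); D. J. Gross, E. Witten,
Phys. Rev. D **21** (1980) 446 (the `d = 2` one-plaquette reduction).  The lemma itself is measure-theoretic
folklore (Fubini on a product of probability spaces).
-/

noncomputable section

open MeasureTheory Finset Function
open scoped ENNReal

namespace Summit.QuantumFields.YangMills.Theorems.MesoscopicConcentrationPivotIntegration

variable {ι : Type*} [DecidableEq ι] {X : ι → Type*} [∀ i, MeasurableSpace (X i)]
variable (μ : ∀ i, Measure (X i)) [∀ i, IsProbabilityMeasure (μ i)]

omit [∀ i, IsProbabilityMeasure (μ i)] in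
/-- **Integrating out a coordinate nobody sees.**  If `g` does not depend on the coordinate `i`, the marginal
integral of `h · g` over `i` is `(∫ h(x[i ↦ y]) dμ_i(y)) · g(x)`. [folklore] -/
theorem lmarginal_singleton_mul_of_indep {h g : (∀ i, X i) → ℝ≥0∞} (i : ι)
    (hh : Measurable h) (hg : ∀ (x : ∀ i, X i) (y : X i), g (update x i y) = g x) (x : ∀ i, X i) :
    (∫⋯∫⁻_{i}, (fun z => h z * g z) ∂μ) x = (∫⁻ y, h (update x i y) ∂μ i) * g x := by
  rw [lmarginal_singleton]
  simp only [hg]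
  exact lintegral_mul_const (g x) (hh.comp (measurable_update x))

/-- **A constant times a function that does not see the coordinate** has marginal integral equal to itself
(probability measure). [folklore] -/
theorem lmarginal_singleton_const_mul_of_indep {g : (∀ i, X i) → ℝ≥0∞} (i : ι) (c : ℝ≥0∞)
    (hg : ∀ (x : ∀ i, X i) (y : X i), g (update x i y) = g x) (x : ∀ i, X i) :
    (∫⋯∫⁻_{i}, (fun z => c * g z) ∂μ) x = c * g x := by
  rw [lmarginal_singleton]
  simp only [hg]
  rw [lintegral_const, measure_univ, mul_one]

variable [Fintype ι]

/-- **PIVOTED PRODUCTS INTEGRATE TO THE PRODUCT OF THEIR PIVOT INTEGRALS.**  Let `π = ⨂_i μ_i` be a finite product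
of probability measures and `(f_k)_{k ∈ F}` measurable `ℝ≥0∞`-valued functions with pivots `piv k` and ranks
`rank k` (any linear order) such that (a) for `k ≠ k'` in `F` with `rank k' ≤ rank k` the factor `f_{k'}` does not depend on the
coordinate `piv k`, and (b) `∫ f_k(x[piv k ↦ y]) dμ_{piv k}(y) = c_k` for all `x`.  Then
`∫ ∏_{k ∈ F} f_k dπ = ∏_{k ∈ F} c_k`.  (Peel off the pivot of the rank-maximal factor, which no other factor sees,
and induct — Seiler's axial-gauge elimination in abstract form.) [folklore] -/
theorem lintegral_prod_eq_prod_of_pivot {κ : Type*} [DecidableEq κ] (F : Finset κ)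
    (f : κ → (∀ i, X i) → ℝ≥0∞) (hf : ∀ k ∈ F, Measurable (f k)) (piv : κ → ι) {R : Type*} [LinearOrder R] (rank : κ → R)
    (hindep : ∀ k ∈ F, ∀ k' ∈ F, k' ≠ k → rank k' ≤ rank k →
      ∀ (x : ∀ i, X i) (y : X (piv k)), f k' (update x (piv k) y) = f k' x)
    (c : κ → ℝ≥0∞) (hc : ∀ k ∈ F, ∀ x : ∀ i, X i, ∫⁻ y, f k (update x (piv k) y) ∂μ (piv k) = c k) :
    ∫⁻ x, ∏ k ∈ F, f k x ∂Measure.pi μ = ∏ k ∈ F, c k := by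
  -- induction on `F`, removing a rank-maximal element each time
  suffices H : ∀ S : Finset κ, S ⊆ F → ∫⁻ x, ∏ k ∈ S, f k x ∂Measure.pi μ = ∏ k ∈ S, c k from H F subset_rfl
  intro S
  induction S using Finset.induction_on_max_value rank with
  | empty => intro _; simp
  | insert a s ha hmax ih =>
    intro hsub
    have haF : a ∈ F := hsub (mem_insert_self a s)
    have hsF : s ⊆ F := fun k hk => hsub (mem_insert_of_mem hk)
    -- the product over `s` does not see the pivot of `a`
    have hprod_meas : Measurable fun x : ∀ i, X i => ∏ k ∈ s, f k x :=
      Finset.measurable_prod _ fun k hk => hf k (hsF hk)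
    have hprod_indep : ∀ (x : ∀ i, X i) (y : X (piv a)),
        (∏ k ∈ s, f k (update x (piv a) y)) = ∏ k ∈ s, f k x := by
      intro x y
      refine Finset.prod_congr rfl fun k hk => ?_
      have hka : k ≠ a := fun h => ha (h ▸ hk)
      exact hindep a haF k (hsF hk) hka (hmax k hk) x y
    -- both `f a · ∏_s` and `c a · ∏_s` have the same marginal over `{piv a}`
    have hmarg : ∫⋯∫⁻_{piv a}, (fun x => f a x * ∏ k ∈ s, f k x) ∂μ =
        ∫⋯∫⁻_{piv a}, (fun x => c a * ∏ k ∈ s, f k x) ∂μ := by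
      funext x
      rw [lmarginal_singleton_mul_of_indep μ (piv a) (hf a haF) hprod_indep x,
        lmarginal_singleton_const_mul_of_indep μ (piv a) (c a) hprod_indep x, hc a haF x]
    have hmeas1 : Measurable fun x : ∀ i, X i => f a x * ∏ k ∈ s, f k x := (hf a haF).mul hprod_meas
    have hmeas2 : Measurable fun x : ∀ i, X i => c a * ∏ k ∈ s, f k x := hprod_meas.const_mul _
    calc ∫⁻ x, ∏ k ∈ insert a s, f k x ∂Measure.pi μ
        = ∫⁻ x, f a x * ∏ k ∈ s, f k x ∂Measure.pi μ := by
          simp only [Finset.prod_insert ha]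
      _ = ∫⁻ x, c a * ∏ k ∈ s, f k x ∂Measure.pi μ := lintegral_eq_of_lmarginal_eq {piv a} hmeas1 hmeas2 hmarg
      _ = c a * ∫⁻ x, ∏ k ∈ s, f k x ∂Measure.pi μ := lintegral_const_mul _ hprod_meas
      _ = c a * ∏ k ∈ s, c k := by rw [ih hsF]
      _ = ∏ k ∈ insert a s, c k := by rw [Finset.prod_insert ha]

/-- **Private-coordinate form** (no ranks): if every factor `f_k` does not depend on the pivot of any OTHER factor,
`∫ ∏_{k ∈ F} f_k dπ = ∏_{k ∈ F} c_k`.  The gauge-tree lower bound uses this with one factor per cotree link.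
[folklore] -/
theorem lintegral_prod_eq_prod_of_private {κ : Type*} [DecidableEq κ] (F : Finset κ)
    (f : κ → (∀ i, X i) → ℝ≥0∞) (hf : ∀ k ∈ F, Measurable (f k)) (piv : κ → ι)
    (hindep : ∀ k ∈ F, ∀ k' ∈ F, k' ≠ k → ∀ (x : ∀ i, X i) (y : X (piv k)), f k' (update x (piv k) y) = f k' x)
    (c : κ → ℝ≥0∞) (hc : ∀ k ∈ F, ∀ x : ∀ i, X i, ∫⁻ y, f k (update x (piv k) y) ∂μ (piv k) = c k) :
    ∫⁻ x, ∏ k ∈ F, f k x ∂Measure.pi μ = ∏ k ∈ F, c k :=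
  lintegral_prod_eq_prod_of_pivot μ F f hf piv (fun _ => (0 : ℕ)) (fun k hk k' hk' hne _ => hindep k hk k' hk' hne) c hc

/-- **Upper-bound form**: if `0 ≤ g ≤ ∏_{k ∈ F} f_k` pointwise (e.g. the full Boltzmann weight against the weight of a
sub-family of plaquettes), then `∫ g dπ ≤ ∏_{k ∈ F} c_k`. [folklore] -/
theorem lintegral_le_prod_of_pivot {κ : Type*} [DecidableEq κ] (F : Finset κ)
    (f : κ → (∀ i, X i) → ℝ≥0∞) (hf : ∀ k ∈ F, Measurable (f k)) (piv : κ → ι) {R : Type*} [LinearOrder R] (rank : κ → R)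
    (hindep : ∀ k ∈ F, ∀ k' ∈ F, k' ≠ k → rank k' ≤ rank k →
      ∀ (x : ∀ i, X i) (y : X (piv k)), f k' (update x (piv k) y) = f k' x)
    (c : κ → ℝ≥0∞) (hc : ∀ k ∈ F, ∀ x : ∀ i, X i, ∫⁻ y, f k (update x (piv k) y) ∂μ (piv k) = c k)
    {g : (∀ i, X i) → ℝ≥0∞} (hg : ∀ x, g x ≤ ∏ k ∈ F, f k x) :
    ∫⁻ x, g x ∂Measure.pi μ ≤ ∏ k ∈ F, c k := by
  rw [← lintegral_prod_eq_prod_of_pivot μ F f hf piv rank hindep c hc]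
  exact lintegral_mono hg

end Summit.QuantumFields.YangMills.Theorems.MesoscopicConcentrationPivotIntegration

end
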